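import Summits.BirchSwinnertonDyer.BirchSwinnertonDyer.Theorems.KimAtThreeFineKatoKPortJunction
import Summits.BirchSwinnertonDyer.BirchSwinnertonDyer.Theorems.KimAtThreeFineKatoKPortLogLatticeUnit
import HarnessLib

/-!
# K-PORT junction (T5): hKloc clause (d) COMPLETE at a tame factor `w ∣ 3` of `ℚ(ζ_m)` (`3 ∤ m`) —
# `Λ₀ʷ ⊆ 𝒪_w`, `0 ∈ Λ₀ʷ`, and an element of UNIT TRACE `‖e₃⁻¹ Tr_{L_w/ℚ_v} ℓ₀‖ = 1` on the Kato stratum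
# (cell `bsd-addord`, seat w2-kport gen 2; `--supports stmt-BirchSwinnertonDyer-19560`, helper)

HONEST FRAMING. Route W2 (`route-BirchSwinnertonDyer-KimAtThreeKolyvagin`), crux 19560
`KatoKuriharaPortThreeShared`, registered line `perFactorKato` (stub hKloc, kim3 LEAD), clause (d) = (K5)
= "per factor `w ∣ 3`: a log-lattice `Λ₀ʷ ⊆ 𝒪_w ∋ 0`, and at ONE factor an element with
`‖e₃⁻¹ Tr_{L_w/ℚ_v} ℓ₀‖ = 1`" — hypotheses `hΛ₀'`, `h0`, `hu'` of kim3's `semiLocalInt_package_of_perFactor`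
(p495892). `…KPortJunction` delivered the trace identity `e₃⁻¹ Tr ℓ₀ = padicLog X P₀` (`clause_d_package`);
w2-acc4 g4's `exists_norm_trace_satLog_eq_one_of_addv` (`…KPortLogLatticeUnit`, p502236) composes the
consumer with kim3's (δ) at `t = 0` over the ABSTRACT `K`. THIS FILE instantiates the latter at
`K := KPort.Kw 3 L w` and reads it in `L_w` through (J1)/(J3): **`clause_d_unit_package`** — for `W/ℚ`
globally minimal, `Addv W 3`, `#E(ℚ₃)[3] = 1`, `L/ℚ` `{m}`-cyclotomic with `e(w∣3) = 1`
(`Kw.ramificationIdx_eq_one_of_isCyclotomicExtension`, `3 ∤ m`), the set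
`Λ₀ʷ := {Λ̃ P : P ∈ E₀(K_w)} ⊆ L_w` satisfies `hΛ₀' w`, `h0 w` and `hu'` (with `w₀ := w`) VERBATIM.
TOOL theorem only (no definition, no named fact, no `sorry`); closes nothing by itself; nothing booked;
BSD / 19560 are not proved by any of this (clauses (e), (f), (g), R-κ, hker/hdual remain — kim3 memo
KIM3-W2-C1c-SEMILOCAL-g14 §7; wild levels `3 ∣ m`: road (R-b), w2-acc4 g5).

References: C.-H. Kim, *AJM* 148 (2026) §3.3 Lemma 3.10–3.11 [Kim2022StructureSelmer]; J. H. Silverman,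
*The Arithmetic of Elliptic Curves*, 2nd ed. (2009), IV.6.4, VII.2 [SilvermanAEC2009];
J. W. S. Cassels, A. Fröhlich, *Algebraic Number Theory* (1967), Ch. II §10 [CasselsFrohlichANT1967].
-/

noncomputable section

-- the cell's Theorems namespace `Summit.BirchSwinnertonDyer.BirchSwinnertonDyer.…` repeats the summit name by design (D-0017)
set_option linter.dupNamespace false

open scoped NNReal
open IsDedekindDomain NumberField

namespace Summit.BirchSwinnertonDyer.BirchSwinnertonDyer.Theorems.KPort

open Literature.NumberTheory.GaloisRepresentations.LubinTate (unitBall mem_unitBall_iff)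


section ClauseDUnit

open Summit.BirchSwinnertonDyer.Rank1Residual.Additive Summit.BirchSwinnertonDyer.Rank1Residual.Additive.BallEval
open Summit.BirchSwinnertonDyer.Rank1Residual.Additive.LocalLog Literature.NumberTheory.EllipticCurves.Rank1Residual
open WeierstrassCurve

variable {L : Type} [Field L] [NumberField L]
  (w : ((Rat.HeightOneSpectrum.primesEquiv (R := 𝓞 ℚ)).symm ⟨3, Fact.out⟩).Extension (𝓞 L))

open scoped Classical in
/-- **hKloc clause (d) at the factor `w`, ALL THREE inputs verbatim** (`hΛ₀' w`, `h0 w`, and `hu'` with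
`w₀ := w`) for `Λ₀ʷ := {Λ̃ P : P ∈ E₀(K_w)}`: `W/ℚ` globally minimal with `Addv W 3` on the KATO STRATUM
`#E(ℚ₃)[3] = 1` (`ht`), `L/ℚ` `{m}`-cyclotomic with `e(w∣3) = 1` (`3 ∤ m`). Then `Λ₀ʷ ⊆ 𝒪_w`, `0 ∈ Λ₀ʷ`, and
**`∃ ℓ₀ ∈ Λ₀ʷ, ‖e₃⁻¹(Tr_{L_w/ℚ_v} ℓ₀)‖ = 1`** — w2-acc4's `exists_norm_trace_satLog_eq_one_of_addv`
(`KPort.consumer_of_addv` ∘ kim3's (δ)) at `K := K_w`, read in `L_w` by (J1)/(J3).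
[cite: Kim2022StructureSelmer, §3.3 Lemma 3.10–3.11] [cite: SilvermanAEC2009, IV.6.4 and VII.2 Prop. 2.1–2.2] -/
theorem clause_d_unit_package (m : ℕ) [NeZero m] [IsCyclotomicExtension {m} ℚ L]
    [he : Fact (w.1.asIdeal.ramificationIdx (𝓞 ℚ) = 1)]
    (W : WeierstrassCurve ℚ) [W.IsElliptic] [W.IsGloballyMinimal]
    [hE : (((integralModelInt W).map (Int.castRingHom ℤ_[3])).map PadicInt.Coe.ringHom).IsElliptic]
    [hX : (((integralModelInt W).map (Int.castRingHom ℤ_[3])).map PadicInt.Coe.ringHom).IsIntegral ℤ_[3]]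
    [hX' : (((integralModelInt W).map (Int.castRingHom ℤ_[3])).map PadicInt.Coe.ringHom).IsIntegral
      (NormedField.valuation (K := ℚ_[3])).integer]
    [hmin : (((integralModelInt W).map (Int.castRingHom ℤ_[3])).map PadicInt.Coe.ringHom).IsMinimal ℤ_[3]]
    [hint : (curveK 3 (Kw 3 L w) ((integralModelInt W).map (Int.castRingHom ℤ_[3]))).IsIntegral
      (NormedField.valuation (K := Kw 3 L w)).integer]
    (hadd : Addv W 3) (ht : Nat.card {Q : (W.baseChange ℚ_[3]).toAffine.Point // (3 : ℕ) • Q = 0} = 1) :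
    ({x : w.1.adicCompletion L | ∃ P ∈ (((integralModelInt W).map (Int.castRingHom ℤ_[3])).map
          (coeffHom 3 (Kw 3 L w))).nonsingularReductionSubgroup
          (Valuation.integer.integers (NormedField.valuation (K := Kw 3 L w))),
        Kw.toCompletion 3 L w (satLog 3 (Kw 3 L w) ((integralModelInt W).map (Int.castRingHom ℤ_[3])) P) = x} ⊆
      w.1.adicCompletionIntegers L) ∧
    ((0 : w.1.adicCompletion L) ∈
      {x : w.1.adicCompletion L | ∃ P ∈ (((integralModelInt W).map (Int.castRingHom ℤ_[3])).map
          (coeffHom 3 (Kw 3 L w))).nonsingularReductionSubgroup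
          (Valuation.integer.integers (NormedField.valuation (K := Kw 3 L w))),
        Kw.toCompletion 3 L w (satLog 3 (Kw 3 L w) ((integralModelInt W).map (Int.castRingHom ℤ_[3])) P) = x}) ∧
    (∃ ℓ₀ ∈ {x : w.1.adicCompletion L | ∃ P ∈ (((integralModelInt W).map (Int.castRingHom ℤ_[3])).map
          (coeffHom 3 (Kw 3 L w))).nonsingularReductionSubgroup
          (Valuation.integer.integers (NormedField.valuation (K := Kw 3 L w))),
        Kw.toCompletion 3 L w (satLog 3 (Kw 3 L w) ((integralModelInt W).map (Int.castRingHom ℤ_[3])) P) = x},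
      ‖(Padic.adicCompletionEquiv (𝓞 ℚ) ⟨3, Fact.out⟩).symm
          (Algebra.trace (((Rat.HeightOneSpectrum.primesEquiv (R := 𝓞 ℚ)).symm ⟨3, Fact.out⟩).adicCompletion ℚ)
            (w.1.adicCompletion L) ℓ₀)‖ = 1) := by
  obtain ⟨hsub, h0, -⟩ := clause_d_package w m W hadd
  haveI := Kw.isGalois (p := 3) (L := L) (w := w) m
  have hK : ∀ x : Kw 3 L w, ‖x‖ < 1 → ‖x‖ ≤ ‖((3 : ℕ) : Kw 3 L w)‖ :=
    Kw.norm_le_norm_prime_of_norm_lt_one (p := 3) he.out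
  obtain ⟨⟨P, hP, hunit⟩, -⟩ := exists_norm_trace_satLog_eq_one_of_addv (K := Kw 3 L w) W hadd hK ht
  refine ⟨hsub, h0, _, ⟨P, hP, rfl⟩, ?_⟩
  rw [← Kw.trace_eq]
  exact hunit

end ClauseDUnit

end Summit.BirchSwinnertonDyer.BirchSwinnertonDyer.Theorems.KPort

end
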